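import Literature.Computability.Cryptography.Postselection
import Literature.Computability.Cryptography.QuantumCircuitProofs
import Literature.Computability.Complexity.CountingHierarchyPH
import Literature.Computability.Complexity.CountingHierarchyInter
import HarnessLib

/-!
# `PostBPP ⊆ PP`, `BPP ⊆ PostBPP` and `Pr[post = 1] ≤ 1` (proofs; trunk CryptoQuantFine, outline Q4)

Sibling proof file of `Postselection.lean` (D-0014). It discharges the named facts

* `Literature.Computability.Cryptography.PostBPP_subset_PP` (`PostBPP_subset_PP_holds`): post-selected bounded-error
  probabilistic polynomial time (`PostBPP`, Han–Hemaspaandra–Thierauf's `BPP_path`) is contained in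
  `PP` (the tree's `PP = pMajority P`, Gill's strict-majority form);
* `Literature.Computability.Cryptography.BPP_subset_PostBPP` (`BPP_subset_PostBPP_holds`): `BPP ⊆ PostBPP`
  (Han–Hemaspaandra–Thierauf's `BPP ⊆ BPP_path`: a normalized machine is a threshold machine; in
  the postselection presentation, the trivial postselect predicate `S := ⊤`);
* `Literature.Computability.Cryptography.QCircuit.postselectProb_le_one`
  (`QCircuit.postselectProb_le_one_holds`, at the end of the file): over a unitary gate set the
  postselection probability `Pr[post = 1]` of a circuit run on `|x⟩|0^m⟩` — the Born probability
  of the event "wire `1` reads `true`" in Aaronson's Def. 1 — is at most `1`: it is a sub-sum of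
  the squared amplitudes of the output state `U_C |x 0^m⟩`, which is a unit vector
  (`QCircuit.normSq_runOn_basisState`, `QuantumCircuitProofs.lean`: circuits over a unitary gate
  set are unitary and unitaries preserve the norm), and those squared amplitudes sum to `1`
  (Nielsen–Chuang, Postulate 3, eq. (2.95): "probabilities sum to one").

## The printed argument, as formalised

Han–Hemaspaandra–Thierauf (SIAM J. Comput. 26 (1997), §2, p. 6) remark that
`R_path ⊆ BPP_path ⊆ PP_path` is immediate and give Simon's proof of `PP_path = PP` (Thm. 2.3
[Sim75]): pad every computation path to full length; "on the leftmost path of this appended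
subtree, `M'` branches into two accepting (rejecting) paths, if `M` accepted (rejected) on the path
`y`. On each remaining path of the subtree, `M'` branches into one accepting and one rejecting
path", so that `M'` has `2^{q+1}` paths of which `2^q + acc - rej` accept. In the tree's
random-string presentation of `PostBPP` (predicates `R, S ∈ P` on `⟨x, r⟩`, `r ∈ {0,1}^{p|x|}`,
thresholds `2/3, 1/3` conditioned on `S`) this is one extra coin `b`: the `P`-predicate
`L' = {⟨x, b r⟩ | (⟨x,r⟩ ∈ S ∧ ⟨x,r⟩ ∈ R) ∨ (⟨x,r⟩ ∉ S ∧ b = 1)}` (strip the coin with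
`dropSndFn 1`, `CoinTruncation.lean`; read it with `sndStartsWith`, `CountingHierarchyPH.lean`;
Boolean closure of `P`, `StringCopy.lean`/`Classes.lean`) has
`Pr[L'] = (2·Pr[S ∧ R] + 1 - Pr[S]) / 2` (`cnt_succ`, `CoinCounting.lean`), which exceeds `1/2`
iff `Pr[S] < 2·Pr[S ∧ R]`; on `x ∈ L`, `Pr[S ∧ R] ≥ (2/3)·Pr[S] > Pr[S]/2` as `Pr[S] > 0`, and
off `L`, `Pr[S ∧ R] ≤ (1/3)·Pr[S] ≤ Pr[S]/2`.

## `BPP ⊆ BPP_path`, as formalised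

Han–Hemaspaandra–Thierauf (§2.1, the paragraph after Def. 2.2, typescript p. 6): "R, BPP, and PP
sets can be accepted via normalized probabilistic polynomial-time Turing machines … for normalized
machines, the probabilistic interpretation of the machine accepts the same set as the threshold
interpretation of the machine. Thus, each of the probabilistic classes is contained in the
corresponding threshold class, i.e., PP ⊆ PP_path, BPP ⊆ BPP_path and R ⊆ R_path." The tree's
`BPP = bp P` is already in normalized (random-strings) form — one `P`-predicate `L'` read on
`⟨x, r⟩`, `r` uniform in `{0,1}^{p|x|}` — so in the postselection presentation of `PostBPP` one
takes the accept predicate `R := L'`, the trivial postselect predicate `S := ⊤ ∈ P` (`top_mem_P`,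
`CountingHierarchyInter.lean`) and the same coin polynomial: `Pr[S] = 1 > 0` (`uniformProb_univ`),
`Pr[S ∧ R] = Pr[R]`, and the `bp` guarantee `Pr[⟨x,r⟩ ∈ L' ↔ x ∈ L] ≥ 2/3` reads `Pr[R] ≥ 2/3` on
`x ∈ L` and `Pr[R] = 1 - Pr[Rᶜ] ≤ 1/3` off `L` (`uniformProb_compl`, `CoinCounting.lean`).

## References

* Y. Han, L. A. Hemaspaandra, T. Thierauf, *Threshold computation and cryptographic security*,
  SIAM J. Comput. 26 (1997) 59–78: Def. 2.2 (`BPP_path`), §2 p. 6 (`BPP_path ⊆ PP_path`;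
  `BPP ⊆ BPP_path` via normalized machines), Thm. 2.3 (`PP_path = PP`, after J. Simon, *On some
  central problems in computational complexity*, PhD thesis, Cornell 1975).
* S. Aaronson, *Quantum computing, postselection, and probabilistic polynomial-time*,
  Proc. R. Soc. A 461 (2005) 3473–3482, doi:10.1098/rspa.2005.1546, arXiv:quant-ph/0412187:
  §2 (`PostBPP = BPP_path`); §3 Def. 1 (`PostBQP`: "(i) After `C_n` is applied to the state
  `|0⋯0⟩ ⊗ |x⟩`, the first qubit has a nonzero probability of being measured to be `|1⟩`" — the
  postselection probability is a Born probability of a computational-basis measurement).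
* M. A. Nielsen, I. L. Chuang, *Quantum Computation and Quantum Information*, 10th anniversary
  ed., CUP 2010 (doi:10.1017/cbo9780511976667): §2.2.3 Postulate 3, eqs. (2.92)–(2.95), book
  pp. 84–85 = PDF p. 131 of the held copy ("The completeness equation expresses the fact that
  probabilities sum to one: `1 = Σ_m p(m)`"); §2.2.5 eq. (2.103), book p. 87 = PDF p. 134
  (measurement in the computational basis, `p(m) = ⟨ψ|P_m|ψ⟩`); §2.1.6 (unitary operators
  preserve inner products).
* M. J. Bremner, R. Jozsa, D. J. Shepherd, Proc. R. Soc. A 467 (2011) 459–472,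
  arXiv:1005.1407, §2.4 p. 6 ("BPP_path … is easily seen to be equal to our class post-BPP") and
  proof of Thm. 2 (p. 8: `post-BPP ⊆ post-BQP = PP`).
-/

namespace Literature.Computability.Cryptography

open _root_.Computability Complexity Complexity.Classes Polynomial Finset

/-! ### `uniformProb` bookkeeping (file-local) -/

/-- `uniformProb` as a normalised count over `List.Vector Bool m` (definitional). [folklore] -/
private theorem uniformProb_eq_card_filter (m : ℕ) (E : Set (List Bool))
    [DecidablePred fun r : List.Vector Bool m => r.toList ∈ E] :
    uniformProb m E = ((univ.filter fun r : List.Vector Bool m => r.toList ∈ E).card : ℝ) / 2 ^ m := by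
  unfold uniformProb
  congr

/-- Additivity: `Pr[E ∧ F] + Pr[E ∧ ¬F] = Pr[E]`. [Arora–Barak 2009, §7.1] [folklore] -/
private theorem uniformProb_inter_add_inter_compl (m : ℕ) (E F : Set (List Bool)) :
    uniformProb m {r | r ∈ E ∧ r ∈ F} + uniformProb m {r | r ∈ E ∧ r ∉ F} = uniformProb m E := by
  classical
  rw [uniformProb_eq_card_filter, uniformProb_eq_card_filter, uniformProb_eq_card_filter,
    ← add_div]
  congr 1
  have h := Finset.card_filter_add_card_filter_not
    (s := univ.filter fun r : List.Vector Bool m => r.toList ∈ E) (fun r => r.toList ∈ F)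
  rw [Finset.filter_filter, Finset.filter_filter] at h
  exact_mod_cast h

/-- Extensionality of `uniformProb m` on strings of length `m` (`cnt_congr`). [folklore] -/
private theorem uniformProb_congr {m : ℕ} {E F : Set (List Bool)}
    (h : ∀ r : List Bool, r.length = m → (r ∈ E ↔ r ∈ F)) : uniformProb m E = uniformProb m F := by
  rw [uniformProb_eq_cnt_div, uniformProb_eq_cnt_div, cnt_congr h]

/-- **Splitting on the first coin**: `Pr_{m+1}[E] = (Pr_m[{y | 0y ∈ E}] + Pr_m[{y | 1y ∈ E}]) / 2`
(`cnt_succ`). (HHT 1997, proof of Thm. 2.3: the appended binary subtree.) [folklore] -/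
private theorem uniformProb_succ (m : ℕ) (E : Set (List Bool)) :
    uniformProb (m + 1) E =
      (uniformProb m {y | false :: y ∈ E} + uniformProb m {y | true :: y ∈ E}) / 2 := by
  rw [uniformProb_eq_cnt_div, uniformProb_eq_cnt_div, uniformProb_eq_cnt_div, cnt_succ, pow_succ]
  push_cast
  field_simp

/-! ### The discharge -/

/-- **Discharge of `PostBPP_subset_PP`** (`BPP_path ⊆ PP_path = PP`): given the predicates
`R, S ∈ P` and the coin polynomial `p` of `L ∈ PostBPP`, use one extra coin `b` and the
`P`-predicate `L' = {⟨x, b r⟩ | (⟨x,r⟩ ∈ S ∧ ⟨x,r⟩ ∈ R) ∨ (⟨x,r⟩ ∉ S ∧ b = 1)}` with `p + 1`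
coins (Simon's padding: two accepting paths per post-selected accepting path, none per
post-selected rejecting path, one of two per discarded path); then
`Pr[L'] = (2·Pr[S ∧ R] + 1 - Pr[S]) / 2 > 1/2` iff `Pr[S] < 2·Pr[S ∧ R]` iff `x ∈ L`.
(Han–Hemaspaandra–Thierauf 1997, §2 p. 6 (`BPP_path ⊆ PP_path`) and Thm. 2.3 (`PP_path = PP`,
[Sim75]); the fact's own docstring locator "Thm. 3.6" is HHT's Cor. 3.6 `NP^BPP ⊆ BPP_path`, a
different statement.) [cite: HanHemaspaandraThierauf1997, §2 (p. 6) and Thm. 2.3] -/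
theorem PostBPP_subset_PP_holds : PostBPP_subset_PP := by
  rintro L ⟨R, hR, S, hS, p, h⟩
  -- strip the extra coin: `D ⟨x, b r⟩ = ⟨x, r⟩`
  set D : List Bool → List Bool := dropSndFn 1 with hD
  have hDFP : D ∈ FP := dropSndFn_mem_FP 1
  have hDpair : ∀ x r : List Bool, ∀ b : Bool, D (boolPair x (b :: r)) = boolPair x r := by
    intro x r b
    rw [hD, dropSndFn_boolPair, eval_one, List.drop_one, List.tail_cons]
  set S' : Language Bool := {w | D w ∈ S} with hS'def
  set R' : Language Bool := {w | D w ∈ R} with hR'def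
  have hS' : S' ∈ P := preimage_mem_P (f := D) hS hDFP
  have hR' : R' ∈ P := preimage_mem_P (f := D) hR hDFP
  -- the `PP` predicate
  set L' : Language Bool := (S' ⊓ R') ⊔ (S'ᶜ ⊓ sndStartsWith true) with hL'def
  have hL' : L' ∈ P :=
    union_mem_P (inter_mem_P hS' hR') (inter_mem_P (compl_mem_P_iff.2 hS') (sndStartsWith_mem_P true))
  refine ⟨L', hL', p + 1, fun x => ?_⟩
  obtain ⟨hpos, hyes, hno⟩ := h x
  have hm : (p + 1).eval x.length = p.eval x.length + 1 := by rw [eval_add, eval_one]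
  rw [hm, uniformProb_succ]
  have hmem : ∀ (b : Bool) (r : List Bool), boolPair x (b :: r) ∈ L' ↔
      (boolPair x r ∈ S ∧ boolPair x r ∈ R) ∨ (boolPair x r ∉ S ∧ b = true) := by
    intro b r
    show (D (boolPair x (b :: r)) ∈ S ∧ D (boolPair x (b :: r)) ∈ R) ∨
      (¬ D (boolPair x (b :: r)) ∈ S ∧ boolPair x (b :: r) ∈ sndStartsWith true) ↔ _
    rw [hDpair, boolPair_mem_sndStartsWith, List.head?_cons, Option.some_inj]
  -- coin `0`: exactly the post-selected accepting strings
  have h0 : uniformProb (p.eval x.length) {r | false :: r ∈ {r | boolPair x r ∈ L'}} =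
      uniformProb (p.eval x.length) {r | boolPair x r ∈ S ∧ boolPair x r ∈ R} := by
    refine uniformProb_congr fun r _ => ?_
    show boolPair x (false :: r) ∈ L' ↔ _
    rw [hmem]
    simp
  -- coin `1`: the post-selected accepting strings and the discarded strings
  have h1 : uniformProb (p.eval x.length) {r | true :: r ∈ {r | boolPair x r ∈ L'}} =
      uniformProb (p.eval x.length) {r | boolPair x r ∈ S ∧ boolPair x r ∈ R} +
        (1 - uniformProb (p.eval x.length) {r | boolPair x r ∈ S}) := by
    rw [← uniformProb_compl, ← uniformProb_inter_add_inter_compl _ _ {r | boolPair x r ∈ S}]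
    congr 1
    · refine uniformProb_congr fun r _ => ?_
      show (boolPair x (true :: r) ∈ L' ∧ boolPair x r ∈ S) ↔ boolPair x r ∈ S ∧ boolPair x r ∈ R
      rw [hmem]
      tauto
    · refine uniformProb_congr fun r _ => ?_
      show (boolPair x (true :: r) ∈ L' ∧ boolPair x r ∉ S) ↔ boolPair x r ∉ S
      rw [hmem]
      tauto
  rw [h0, h1]
  constructor
  · intro hx
    have := hyes hx
    linarith
  · intro hlt
    by_contra hx
    have := hno hx
    linarith

/-! ### `BPP ⊆ PostBPP` -/

/-- **Discharge of `BPP_subset_PostBPP`** (`BPP ⊆ BPP_path = PostBPP`): given the `P`-predicate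
`L'` and the coin polynomial `p` of `L ∈ BPP = bp P` (a normalized machine: every coin string has
length exactly `p |x|`), take the accept predicate `R := L'`, the trivial postselect predicate
`S := ⊤ ∈ P` and the same `p`. Then `Pr[S] = 1 > 0` and `Pr[S ∧ R] = Pr[R]`, which is `≥ 2/3`
on `x ∈ L` and `= 1 - Pr[Rᶜ] ≤ 1/3` off `L` by the `bp` guarantee
`Pr[⟨x,r⟩ ∈ L' ↔ x ∈ L] ≥ 2/3` — "for normalized machines, the probabilistic interpretation of
the machine accepts the same set as the threshold interpretation … Thus … BPP ⊆ BPP_path"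
(Han–Hemaspaandra–Thierauf 1997, §2.1, paragraph after Def. 2.2, p. 6; the identification
`PostBPP = BPP_path` is Aaronson 2005, §2).
[cite: HanHemaspaandraThierauf1997, §2.1 (after Def. 2.2, p. 6)] -/
theorem BPP_subset_PostBPP_holds : BPP_subset_PostBPP := by
  rintro L ⟨L', hL', p, h⟩
  refine ⟨L', hL', ⊤, top_mem_P, p, fun x => ?_⟩
  -- the postselect predicate `⊤` is hit by every coin string
  have hS : {r : List Bool | boolPair x r ∈ (⊤ : Language Bool)} = Set.univ :=
    Set.eq_univ_of_forall fun _ => trivial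
  have hSR : {r : List Bool | boolPair x r ∈ (⊤ : Language Bool) ∧ boolPair x r ∈ L'} =
      {r : List Bool | boolPair x r ∈ L'} :=
    Set.ext fun _ => ⟨fun hr => hr.2, fun hr => ⟨trivial, hr⟩⟩
  rw [hS, hSR, uniformProb_univ]
  have hx := h x
  refine ⟨one_pos, fun hxL => ?_, fun hxL => ?_⟩
  · -- on `x ∈ L` the correct-verdict event is the acceptance event
    have hset : {y : List Bool | boolPair x y ∈ L' ↔ x ∈ L} = {y : List Bool | boolPair x y ∈ L'} :=
      Set.ext fun _ => iff_true_right hxL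
    rw [hset] at hx
    linarith
  · -- off `L` it is the rejection event, of probability `1 - Pr[accept]`
    have hset : {y : List Bool | boolPair x y ∈ L' ↔ x ∈ L} = {y : List Bool | boolPair x y ∈ L'}ᶜ :=
      Set.ext fun _ => iff_false_right hxL
    rw [hset, uniformProb_compl] at hx
    linarith

/-! ### `Pr[post = 1] ≤ 1` over a unitary gate set -/

section PostselectProbLeOne

variable {G : QGateSet} {n m : ℕ}

/-- **Discharge of `QCircuit.postselectProb_le_one`.** Over a unitary gate set the postselection
probability `Pr[post = 1] = ∑_{y, y₁ = 1} |(U_C |x 0^m⟩)(y)|²` of a circuit `C` on `n + m` wires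
run (relative to any oracle `A`) on `|x⟩|0^m⟩` is at most `1`: it is the Born probability
(`QCircuit.probEvent`) of the event `postselectEvent (n + m)` — in Aaronson's Def. 1 (i), the
probability that the postselection qubit is "measured to be `|1⟩`" after `C_n` is applied to
`|0⋯0⟩ ⊗ |x⟩` — i.e. a sub-sum of the squared amplitudes `|(U_C |x 0^m⟩)(y)|²` of the output
state; the output state is a unit vector (`QCircuit.normSq_runOn_basisState`: `U_C` is unitary
for a unitary gate set, `QCircuit.toMatrix_mem_unitaryGroup_holds`, and unitaries preserve the
norm of the unit vector `|x 0^m⟩`), so the full sum is `1` and every sub-sum of nonnegative terms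
is `≤ 1`. This is the statement that the outcome probabilities `p(m) = ⟨ψ|M_m† M_m|ψ⟩` of a
measurement of a unit vector sum to one by the completeness equation (Nielsen–Chuang 2010,
§2.2.3 Postulate 3, eqs. (2.92)–(2.95), book pp. 84–85), here for the measurement of all wires in
the computational basis (§2.2.5, eq. (2.103), p. 87). No hypothesis `2 ≤ n + m` is needed: in the
junk case the event is empty and the probability is `0 ≤ 1`.
[cite: Aaronson2005, §3 Def. 1 (i)] [cite: NielsenChuang2010, §2.2.3 eqs. (2.92)–(2.95) pp. 84–85] -/
theorem QCircuit.postselectProb_le_one_holds :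
    QCircuit.postselectProb_le_one (G := G) (n := n) (m := m) := by
  intro hG A C x
  rw [← QCircuit.normSq_runOn_basisState hG A C x, QCircuit.postselectProb]
  classical
  unfold QCircuit.probEvent normSq
  exact Finset.sum_le_sum_of_subset_of_nonneg (Finset.filter_subset _ _)
    fun _ _ _ => by positivity

end PostselectProbLeOne

end Literature.Computability.Cryptography
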